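import Summits.QuantumAdvantage.QuantumAdvantage.Theorems.CharDialAdaptDialA
import HarnessLib

/-!
# CharDial / JLinPeel — ADAPTED DIAL, part B: Doeblin per WINDOW, and the bridge from a WORD-DRIVEN AUTOMATON (the game chain) to kernels
(route `CharDial`, item 32604; lens-6 node g18 §11.7–§11.8, engine steps (γ)+(δ) of the sixth dial «adapted few-column strategies»)

* `doeblin_window`: stochastic, column-sum-one steps whose WINDOW composites (along boundaries `b 0 = 0 ≤ b 1 ≤ …`) are minorised by `η·uniform`
  give, after `k` windows, a law within `(1−η)^k` of uniform on every event — minorisation is only ever available per window, never per step.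
* `run` / `letterKernel` / `count_run_eq` (COUNTING = PUSHING): for a WORD-driven automaton (finite alphabet `A` per step — for the game chain `A` =
  the `p`-bit words of one block, since cut decisions snapshot the block-boundary state the chain is bijective per BLOCK, not per bit) with
  time-dependent step maps, the number of `m`-letter inputs ending in `{f}` is `|A|^m ·` (mass of `{f}` under the chain of one-letter kernels started at
  the point mass); bijective step maps make the one-letter kernels doubly stochastic (`letterKernel_colSumOne`).
* `automaton_bias_le` (★ the abstract ENGINE): bijective steps + minorised windows + a readout balanced under the uniform law ⇒
  `|#{w : f (run w)} − |A|^m/2| ≤ (1−η)^k · |A|^m`.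
What remains GAME-SPECIFIC for the sixth dial (g19): the state space `𝔽_p^t × ℤ/3 × (parity, pending bit)` of an adapted `t`-column strategy, the
bijectivity of its block-word steps (immediate: translations and state-dependent xors, triangular), and the window minorisation (a character sum over `𝔽_p^t`, node §11.7 (ii)(α)).
0 sorry.
-/

set_option autoImplicit false

namespace Summit.QuantumAdvantage.AdviceFreeQNC0.JLinPeel.AdaptDial

open Finset

variable {S : Type*} [Fintype S]

/-! ### Windows: Doeblin for COMPOSITE kernels (minorisation only per window of steps) -/

section Windows

variable [DecidableEq S]

/-- composition of two kernels (matrix product). -/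
def comp (K L : S → S → ℝ) : S → S → ℝ := fun s t => ∑ r, K s r * L r t

/-- the composite kernel of the steps `K a, K (a+1), …, K (a+m−1)`. -/
def compRange (K : ℕ → S → S → ℝ) (a : ℕ) : ℕ → S → S → ℝ
  | 0 => fun s t => if s = t then 1 else 0
  | m + 1 => comp (compRange K a m) (K (a + m))

omit [DecidableEq S] in
/-- pushing through a composite = pushing twice. -/
theorem push_comp (μ : S → ℝ) (K L : S → S → ℝ) : push μ (comp K L) = push (push μ K) L := by
  funext t
  unfold push comp
  simp_rw [Finset.mul_sum, ← mul_assoc]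
  rw [Finset.sum_comm, ]
  simp_rw [← Finset.sum_mul]

/-- pushing through the identity kernel. -/
theorem push_id (μ : S → ℝ) : push μ (fun s t => if s = t then (1 : ℝ) else 0) = μ := by
  funext t
  unfold push
  rw [Finset.sum_eq_single t]
  · simp
  · intro s _ hs
    simp [hs]
  · simp

/-- `pushIter` restarted at time `a`: the law at time `a + m` is the law at time `a` pushed through the composite of the next `m` steps. -/
theorem pushIter_add (μ : S → ℝ) (K : ℕ → S → S → ℝ) (a m : ℕ) :
    pushIter μ K (a + m) = push (pushIter μ K a) (compRange K a m) := by
  induction m with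
  | zero =>
    show pushIter μ K a = push (pushIter μ K a) (fun s t => if s = t then (1 : ℝ) else 0)
    rw [push_id]
  | succ m ih =>
    show push (pushIter μ K (a + m)) (K (a + m)) = push (pushIter μ K a) (comp (compRange K a m) (K (a + m)))
    rw [push_comp, ← ih]

omit [DecidableEq S] in
/-- the composite of stochastic kernels is stochastic. -/
theorem comp_isStochastic (K L : S → S → ℝ) (hK : IsStochastic K) (hL : IsStochastic L) : IsStochastic (comp K L) := by
  refine ⟨fun s t => Finset.sum_nonneg fun r _ => mul_nonneg (hK.1 s r) (hL.1 r t), fun s => ?_⟩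
  unfold comp
  rw [Finset.sum_comm]
  simp_rw [← Finset.mul_sum, hL.2, mul_one, hK.2]

omit [DecidableEq S] in
/-- the composite of column-sum-one kernels has column sums one. -/
theorem comp_colSumOne (K L : S → S → ℝ) (hK : ColSumOne K) (hL : ColSumOne L) : ColSumOne (comp K L) := by
  intro t
  have hK' : ∀ r, ∑ s, K s r = 1 := hK
  have hL' : ∀ r, ∑ s, L s r = 1 := hL
  unfold comp
  rw [Finset.sum_comm]
  simp_rw [← Finset.sum_mul, hK', one_mul, hL']

/-- the identity kernel is stochastic. -/
theorem id_isStochastic : IsStochastic (fun s t : S => if s = t then (1 : ℝ) else 0) := by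
  refine ⟨fun s t => by dsimp only; split_ifs <;> norm_num, fun s => ?_⟩
  rw [Finset.sum_eq_single s]
  · simp
  · intro t _ ht
    simp [Ne.symm ht]
  · simp

/-- the identity kernel has column sums one. -/
theorem id_colSumOne : ColSumOne (fun s t : S => if s = t then (1 : ℝ) else 0) := by
  intro t
  rw [Finset.sum_eq_single t]
  · simp
  · intro s _ hs
    simp [hs]
  · simp

/-- composites of stochastic steps are stochastic. -/
theorem compRange_isStochastic (K : ℕ → S → S → ℝ) (hK : ∀ j, IsStochastic (K j)) (a m : ℕ) : IsStochastic (compRange K a m) := by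
  induction m with
  | zero => exact id_isStochastic
  | succ m ih => exact comp_isStochastic _ _ ih (hK _)

/-- composites of column-sum-one steps have column sums one. -/
theorem compRange_colSumOne (K : ℕ → S → S → ℝ) (hC : ∀ j, ColSumOne (K j)) (a m : ℕ) : ColSumOne (compRange K a m) := by
  induction m with
  | zero => exact id_colSumOne
  | succ m ih => exact comp_colSumOne _ _ ih (hC _)

/-- the WINDOW kernels of a step sequence along boundaries `b 0 ≤ b 1 ≤ …`: window `j` = steps `b j, …, b (j+1) − 1`. -/
def window (K : ℕ → S → S → ℝ) (b : ℕ → ℕ) (j : ℕ) : S → S → ℝ := compRange K (b j) (b (j + 1) - b j)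

/-- the law at a window boundary is the start law pushed through the window kernels. -/
theorem pushIter_window (μ : S → ℝ) (K : ℕ → S → S → ℝ) (b : ℕ → ℕ) (hb0 : b 0 = 0) (hb : Monotone b) (k : ℕ) :
    pushIter μ K (b k) = pushIter μ (window K b) k := by
  induction k with
  | zero => rw [hb0]; rfl
  | succ k ih =>
    have hle : b k ≤ b (k + 1) := hb (Nat.le_succ k)
    have heq : b (k + 1) = b k + (b (k + 1) - b k) := by omega
    rw [heq, pushIter_add, ih]
    rfl

/-- ★★ **DOEBLIN PER WINDOW.** stochastic, column-sum-one steps whose WINDOW composites are minorised by `η·uniform`: after `k` windows the law is within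
`(1−η)^k` of uniform on every event — the form the sixth dial uses (minorisation is proved per window of `L` blocks, never per step). -/
theorem doeblin_window [Nonempty S] (η : ℝ) (hη1 : η < 1) (K : ℕ → S → S → ℝ)
    (hK : ∀ j, IsStochastic (K j)) (hC : ∀ j, ColSumOne (K j)) (b : ℕ → ℕ) (hb0 : b 0 = 0) (hb : Monotone b)
    (hM : ∀ j, Minorised η (window K b j)) (μ : S → ℝ) (hμ : IsLaw μ) (k : ℕ) (A : Finset S) :
    |∑ s ∈ A, pushIter μ K (b k) s - A.card / Fintype.card S| ≤ (1 - η) ^ k := by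
  rw [pushIter_window μ K b hb0 hb k]
  exact doeblin η hη1 (window K b) (fun j => compRange_isStochastic K hK _ _) (fun j => compRange_colSumOne K hC _ _) hM μ hμ k A

end Windows

/-! ### The bridge from a WORD-DRIVEN automaton (the game chain, one block word per step) to kernels: counting inputs = pushing the point mass -/

section Automaton

variable [DecidableEq S] {A : Type*} [Fintype A]

/-- run a word-driven automaton with time-dependent step maps `step i : S → A → S` (alphabet `A`, e.g. the `p`-bit words of one block) on the input
letters `w 0, …, w (m−1)` from state `s`. -/
def run (step : ℕ → S → A → S) : (m : ℕ) → S → (Fin m → A) → S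
  | 0, s, _ => s
  | m + 1, s, w => run (fun i => step (i + 1)) m (step 0 s (w 0)) (Fin.tail w)

/-- the one-letter kernel of step `i`: from `s`, go to `step i s a` for a uniformly random letter `a`. -/
noncomputable def letterKernel (step : ℕ → S → A → S) (i : ℕ) : S → S → ℝ :=
  fun s t => ((univ.filter fun a : A => step i s a = t).card : ℝ) / Fintype.card A

/-- the point mass. -/
def dirac (s₀ : S) : S → ℝ := fun s => if s = s₀ then 1 else 0

/-- the point mass is a law. -/
theorem dirac_isLaw (s₀ : S) : IsLaw (dirac s₀) := by
  refine ⟨fun s => by unfold dirac; split_ifs <;> norm_num, ?_⟩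
  unfold dirac
  rw [Finset.sum_eq_single s₀]
  · simp
  · intro s _ hs
    simp [hs]
  · simp

omit [Fintype S] in
/-- the letter count of a fibre, as a sum of indicators. -/
theorem card_filter_step_eq (step : ℕ → S → A → S) (i : ℕ) (s t : S) :
    ((univ.filter fun a : A => step i s a = t).card : ℝ) = ∑ a : A, if step i s a = t then (1 : ℝ) else 0 := by
  rw [Finset.card_filter]
  push_cast
  rfl

/-- one-letter kernels are stochastic (non-empty alphabet). -/
theorem letterKernel_isStochastic [Nonempty A] (step : ℕ → S → A → S) (i : ℕ) : IsStochastic (letterKernel step i) := by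
  have hA : (0 : ℝ) < Fintype.card A := Nat.cast_pos.mpr Fintype.card_pos
  refine ⟨fun s t => by unfold letterKernel; positivity, fun s => ?_⟩
  unfold letterKernel
  rw [← Finset.sum_div, div_eq_one_iff_eq hA.ne']
  have h := Finset.card_eq_sum_card_fiberwise (s := (univ : Finset A)) (t := (univ : Finset S)) (f := fun a => step i s a)
    (fun a _ => Finset.mem_univ _)
  rw [Finset.card_univ] at h
  exact_mod_cast h.symm

/-- one-letter kernels whose step maps are BIJECTIONS for every letter have column sums one (the uniform law is invariant). -/
theorem letterKernel_colSumOne [Nonempty A] (step : ℕ → S → A → S) (i : ℕ)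
    (hbij : ∀ a, Function.Bijective fun s => step i s a) : ColSumOne (letterKernel step i) := by
  have hA : (0 : ℝ) < Fintype.card A := Nat.cast_pos.mpr Fintype.card_pos
  intro t
  unfold letterKernel
  rw [← Finset.sum_div, div_eq_one_iff_eq hA.ne']
  simp_rw [card_filter_step_eq]
  rw [Finset.sum_comm]
  have hone : ∀ a : A, (∑ s : S, if step i s a = t then (1 : ℝ) else 0) = 1 := by
    intro a
    obtain ⟨s₀, hs₀⟩ := (hbij a).2 t
    rw [Finset.sum_eq_single s₀]
    · simp [hs₀]
    · intro s _ hs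
      have : step i s a ≠ t := fun h => hs ((hbij a).1 (h.trans hs₀.symm))
      simp [this]
    · simp
  simp_rw [hone]
  simp

omit [DecidableEq S] in
/-- `pushIter` peeled at the FIRST step. -/
theorem pushIter_succ_left (μ : S → ℝ) (K : ℕ → S → S → ℝ) (n : ℕ) :
    pushIter μ K (n + 1) = pushIter (push μ (K 0)) (fun i => K (i + 1)) n := by
  induction n with
  | zero => rfl
  | succ n ih =>
    show push (pushIter μ K (n + 1)) (K (n + 1)) = push (pushIter (push μ (K 0)) (fun i => K (i + 1)) n) (K (n + 1))
    rw [ih]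

omit [DecidableEq S] in
/-- `pushIter` commutes with finite sums of start laws. -/
theorem pushIter_sum_law {ι : Type*} (T : Finset ι) (g : ι → S → ℝ) (K : ℕ → S → S → ℝ) (n : ℕ) (t : S) :
    pushIter (fun s => ∑ a ∈ T, g a s) K n t = ∑ a ∈ T, pushIter (g a) K n t := by
  induction n generalizing t with
  | zero => rfl
  | succ n ih =>
    show push (pushIter (fun s => ∑ a ∈ T, g a s) K n) (K n) t = ∑ a ∈ T, push (pushIter (g a) K n) (K n) t
    unfold push
    simp_rw [ih, Finset.sum_mul]
    rw [Finset.sum_comm]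

omit [DecidableEq S] in
/-- `pushIter` is homogeneous in the start law. -/
theorem pushIter_smul_law (c : ℝ) (μ : S → ℝ) (K : ℕ → S → S → ℝ) (n : ℕ) (t : S) :
    pushIter (fun s => c * μ s) K n t = c * pushIter μ K n t := by
  induction n generalizing t with
  | zero => rfl
  | succ n ih =>
    show push (pushIter (fun s => c * μ s) K n) (K n) t = c * push (pushIter μ K n) (K n) t
    unfold push
    rw [Finset.mul_sum]
    refine Finset.sum_congr rfl fun s _ => ?_
    rw [ih s]; ring

/-- the point mass pushed through a one-letter kernel = the uniform mixture of the successor point masses. -/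
theorem push_dirac_letterKernel (step : ℕ → S → A → S) (s₀ : S) (t : S) :
    push (dirac s₀) (letterKernel step 0) t = (1 / Fintype.card A) * ∑ a : A, dirac (step 0 s₀ a) t := by
  unfold push letterKernel
  rw [Finset.sum_eq_single s₀]
  · have hd : dirac s₀ s₀ = 1 := by simp [dirac]
    rw [hd, one_mul, card_filter_step_eq, div_eq_mul_inv, mul_comm]
    congr 1
    · rw [one_div]
    · refine Finset.sum_congr rfl fun a _ => ?_
      unfold dirac
      by_cases h : step 0 s₀ a = t
      · rw [if_pos h, if_pos h.symm]
      · rw [if_neg h, if_neg fun h' => h h'.symm]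
  · intro s _ hs
    simp [dirac, hs]
  · simp

/-- splitting the count of `(m+1)`-letter inputs by the first letter. -/
theorem card_filter_cons {m : ℕ} (P : (Fin (m + 1) → A) → Prop) [DecidablePred P] :
    (univ.filter P).card = ∑ a : A, (univ.filter fun v : Fin m → A => P (Fin.cons a v)).card := by
  simp only [Finset.card_filter]
  rw [← Fintype.sum_equiv (Fin.consEquiv fun _ => A) (fun q => if P (Fin.cons q.1 q.2) then 1 else 0)
    (fun u => if P u then 1 else 0) (fun q => rfl)]
  rw [Fintype.sum_prod_type]

/-- ★ **COUNTING = PUSHING.** the number of `m`-letter inputs driving the automaton from `s₀` into a state where `f` holds is `|A|^m` times the mass that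
the chain of one-letter kernels started at `δ_{s₀}` gives to `{f}`. -/
theorem count_run_eq [Nonempty A] (step : ℕ → S → A → S) (m : ℕ) (s₀ : S) (f : S → Bool) :
    ((univ.filter fun w : Fin m → A => f (run step m s₀ w) = true).card : ℝ)
      = (Fintype.card A : ℝ) ^ m * ∑ t ∈ univ.filter (fun t => f t = true), pushIter (dirac s₀) (letterKernel step) m t := by
  induction m generalizing step s₀ with
  | zero =>
    simp only [pow_zero, one_mul, pushIter]
    unfold dirac
    rw [Finset.sum_ite_eq' (univ.filter fun t => f t = true) s₀]
    by_cases hf : f s₀ = true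
    · have : (univ.filter fun w : Fin 0 → A => f (run step 0 s₀ w) = true) = univ :=
        Finset.filter_true_of_mem fun u _ => hf
      rw [this]; simp [hf]
    · have : (univ.filter fun w : Fin 0 → A => f (run step 0 s₀ w) = true) = ∅ :=
        Finset.filter_false_of_mem fun u _ => hf
      rw [this]; simp [hf]
  | succ m ih =>
    have hA : (Fintype.card A : ℝ) ≠ 0 := Nat.cast_ne_zero.mpr Fintype.card_ne_zero
    rw [card_filter_cons]
    push_cast
    simp only [run, Fin.cons_zero, Fin.tail_cons]
    simp_rw [ih (fun i => step (i + 1))]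
    have hfun : push (dirac s₀) (letterKernel step 0)
        = fun t => (1 / Fintype.card A) * ∑ a : A, dirac (step 0 s₀ a) t :=
      funext (push_dirac_letterKernel step s₀)
    have hbk : (fun i => letterKernel step (i + 1)) = letterKernel (fun i => step (i + 1)) := rfl
    rw [pushIter_succ_left, hfun, hbk]
    simp_rw [pushIter_smul_law, pushIter_sum_law]
    rw [← Finset.mul_sum, Finset.sum_comm, pow_succ, mul_assoc]
    congr 1
    rw [Finset.mul_sum]
    refine Finset.sum_congr rfl fun x _ => ?_
    rw [← mul_assoc, mul_one_div_cancel hA, one_mul]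

/-- ★★★ **THE ENGINE OF THE SIXTH DIAL, abstract form.** a word-driven automaton with bijective step maps, whose WINDOW kernels are minorised by
`η·uniform`, started anywhere: for every Boolean readout `f` of the final state that is balanced under the uniform law (`2·#{f} = |S|`), the number of
`m`-letter inputs with `f = true` is within `(1−η)^k·|A|^m` of `|A|^m/2`, `k` = the number of complete windows (`b k = m`). -/
theorem automaton_bias_le [Nonempty S] [Nonempty A] (step : ℕ → S → A → S) (hbij : ∀ i a, Function.Bijective fun s => step i s a)
    (η : ℝ) (hη1 : η < 1) (b : ℕ → ℕ) (hb0 : b 0 = 0) (hb : Monotone b)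
    (hM : ∀ j, Minorised η (window (letterKernel step) b j)) (k m : ℕ) (hm : b k = m) (s₀ : S) (f : S → Bool)
    (hf : 2 * (univ.filter fun s => f s = true).card = Fintype.card S) :
    |((univ.filter fun w : Fin m → A => f (run step m s₀ w) = true).card : ℝ) - (Fintype.card A : ℝ) ^ m / 2|
      ≤ (1 - η) ^ k * (Fintype.card A : ℝ) ^ m := by
  rw [count_run_eq, ← hm]
  have h := doeblin_window η hη1 (letterKernel step) (fun j => letterKernel_isStochastic step j)
    (fun j => letterKernel_colSumOne step j (hbij j)) b hb0 hb hM (dirac s₀) (dirac_isLaw s₀) k (univ.filter fun s => f s = true)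
  have hcard : (Fintype.card S : ℝ) ≠ 0 := Nat.cast_ne_zero.mpr Fintype.card_ne_zero
  have hhalf : ((univ.filter fun s => f s = true).card : ℝ) / Fintype.card S = 1 / 2 := by
    rw [div_eq_div_iff hcard two_ne_zero, one_mul]
    exact_mod_cast (by simpa [mul_comm] using hf)
  rw [hhalf] at h
  have hpow : (0 : ℝ) ≤ (Fintype.card A : ℝ) ^ b k := by positivity
  have : (Fintype.card A : ℝ) ^ b k * ∑ t ∈ univ.filter (fun t => f t = true), pushIter (dirac s₀) (letterKernel step) (b k) t
        - (Fintype.card A : ℝ) ^ b k / 2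
      = (Fintype.card A : ℝ) ^ b k
        * (∑ t ∈ univ.filter (fun t => f t = true), pushIter (dirac s₀) (letterKernel step) (b k) t - 1 / 2) := by ring
  rw [this, abs_mul, abs_of_nonneg hpow, mul_comm]
  exact mul_le_mul_of_nonneg_right h hpow

end Automaton

end Summit.QuantumAdvantage.AdviceFreeQNC0.JLinPeel.AdaptDial
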